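import Summits.Langlands.Langlands.Theorems.SchurObstructionExitPrelude

/-!
# `SchurObstructionExit` — part 2/2 (cells, `closes_target`, exactness, host corollaries, composition with the g26 chain)

Census twin (decomp-langlands census-1 g28) of the lens-4 g28 node `HOME/nodes/lens-4-g28-SchurObstructionExit.lean` (sha256 8da153df…),
split mechanically at `end Galois` because Theorems files with proofs are ≤ 400 lines; part 1 = `SchurObstructionExitPrelude`
(§0 pieces, §1 abstract Clifford extension group, §2 Galois-side extension).  Deltas vs the node: the deciding theorem `closes` is
renamed `closes_target` (a `--supports … --as helper` file may not declare a registry-owned name); nothing else changed.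
TARGET = tree `TatePhantomLift.PerfectLayerExtension` (EXT, deciding crux of the queued PerfectLayerClifford kit, host RPERF 28225).
-/

set_option linter.dupNamespace false
set_option linter.unusedVariables false
set_option linter.style.longLine false

namespace Summit.Langlands.Langlands.Theorems.SchurObstructionExit


open scoped BigOperators Topology Matrix
open Filter Set Function
open Literature.NumberTheory.GaloisRepresentations Literature.NumberTheory.Automorphic
open IsDedekindDomain
open Summit.Langlands.Langlands.Theses
open Summit.Langlands.Langlands.Theses.GaloisHullLift
open Summit.Langlands.Langlands.Theorems.TatePhantomLift
open scoped NumberField Polynomial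


/-! ## §3 The cells of EXT: Schur-split layers from W1 (PROVED), superperfect layers from nothing (PROVED) -/

/-- **SPLIT ⟸ W1 (PROVED CELL).**  On a perfect layer whose Galois group has its central `μ_n`-type extensions split, an irreducible relative
avatar extends on the nose, given only the determinant descent W1; the extension is irreducible, hence semisimple, and carries the same
relative avatar. -/
theorem schurSplit_of_w1 (hW : LayerDeterminantDescent) : SchurSplitLayerExtension := by
  intro K _ _ n hcpt hn π hπ L _ _ _ hGal h1 hnc hsplit ℓ _ ι r hr hirr hrel
  haveI := hGal
  have hinv : ∀ τ : Field.absoluteGaloisGroup K, ∃ P : GL (Fin n) (PadicAlgCl ℓ),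
      FramedRep.conj P (FramedGaloisRep.outerConj τ r) = r := relAvatar_invariant π.1 ι r hr hrel
  obtain ⟨Ψ, hΨ⟩ := hW K n hcpt hn π hπ L hGal h1 hnc ℓ ι r hr hirr hrel
  obtain ⟨ρ₀, h0⟩ := exists_restrictField_eq_of_det r hirr hinv Ψ.toMonoidHom hΨ hsplit
  have hirr₀ : ρ₀.IsIrreducible := isIrreducible_of_restrictField ρ₀ (h0 ▸ hirr : (ρ₀.restrictField L).IsIrreducible)
  have hss₀ : ρ₀.toGaloisRep.IsSemisimple := by
    haveI : ρ₀.toGaloisRep.toRepresentation.IsIrreducible := hirr₀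
    change ComplementedLattice _
    infer_instance
  refine ⟨ρ₀, hss₀, ?_⟩
  rw [h0]
  exact hrel

/-- **SUPERPERFECT RUNG (PROVED, no piece at all)** — the BC5 witness: EXT holds on every layer with superperfect Galois group. -/
theorem ext_on_superperfect : SuperperfectLayerExtension := by
  intro K _ _ n hcpt hn π hπ L _ _ _ hGal h1 hnc hsplit ℓ _ ι r hr hirr hrel
  haveI := hGal
  have hinv : ∀ τ : Field.absoluteGaloisGroup K, ∃ P : GL (Fin n) (PadicAlgCl ℓ),
      FramedRep.conj P (FramedGaloisRep.outerConj τ r) = r := relAvatar_invariant π.1 ι r hr hrel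
  obtain ⟨ρ₀, h0⟩ := exists_restrictField_eq_of_superperfect r hirr hinv hsplit
  have hirr₀ : ρ₀.IsIrreducible := isIrreducible_of_restrictField ρ₀ (h0 ▸ hirr : (ρ₀.restrictField L).IsIrreducible)
  have hss₀ : ρ₀.toGaloisRep.IsSemisimple := by
    haveI : ρ₀.toGaloisRep.toRepresentation.IsIrreducible := hirr₀
    change ComplementedLattice _
    infer_instance
  refine ⟨ρ₀, hss₀, ?_⟩
  rw [h0]
  exact hrel

/-! ## §4 `closes` (TARGET BY NAME), exactness, S-implications -/

/-- **KERNEL: W1 ∧ SCHT ⟹ EXT** (case on the Schur-torsion predicate of the layer). -/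
theorem ext_of_w1_scht (hW : LayerDeterminantDescent) (hS : SchurTorsionLayerExtension) : PerfectLayerExtension := by
  intro K _ _ n hcpt hn π hπ L _ _ _ hGal h1 hnc ℓ _ ι r hr hirr hrel
  by_cases hsp : CentralExtensionsSplitMod n (L ≃ₐ[K] L)
  · exact schurSplit_of_w1 hW K n hcpt hn π hπ L hGal h1 hnc hsp ℓ ι r hr hirr hrel
  · exact hS K n hcpt hn π hπ L hGal h1 hnc hsp ℓ ι r hr hirr hrel

/-- **closes_target** (the node's `closes`) — the TARGET `TatePhantomLift.PerfectLayerExtension` BY NAME from the two pieces. -/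
theorem closes_target (hW : LayerDeterminantDescent) (hS : SchurTorsionLayerExtension) :
    Summit.Langlands.Langlands.Theorems.TatePhantomLift.PerfectLayerExtension :=
  ext_of_w1_scht hW hS

/-- **SCHT ⟸ EXT** (restriction to fewer layers). -/
theorem scht_of_ext (hE : PerfectLayerExtension) : SchurTorsionLayerExtension := by
  intro K _ _ n hcpt hn π hπ L _ _ _ hGal h1 hnc hsp ℓ _ ι r hr hirr hrel
  exact hE K n hcpt hn π hπ L hGal h1 hnc ℓ ι r hr hirr hrel

/-- **SPLIT ⟸ EXT** (restriction to fewer layers). -/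
theorem schurSplit_of_ext (hE : PerfectLayerExtension) : SchurSplitLayerExtension := by
  intro K _ _ n hcpt hn π hπ L _ _ _ hGal h1 hnc hsp ℓ _ ι r hr hirr hrel
  exact hE K n hcpt hn π hπ L hGal h1 hnc ℓ ι r hr hirr hrel

/-- **EXACTNESS, FACT-FREE**: EXT ↔ W1 ∧ SCHT (`w1_of_ext` is the tree's; no TP / DIV / LAY / RIGID side hypotheses, unlike g26's `ext_iff_pieces`). -/
theorem ext_iff : PerfectLayerExtension ↔ (LayerDeterminantDescent ∧ SchurTorsionLayerExtension) :=
  ⟨fun h => ⟨w1_of_ext h, scht_of_ext h⟩, fun h => ext_of_w1_scht h.1 h.2⟩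

/-- SCHT is S-implied (via EXT). -/
theorem scht_of_langlands (hL : _root_.Langlands) : SchurTorsionLayerExtension := scht_of_ext (ext_of_langlands hL)

/-- SCHT is implied by the host item RPERF (via EXT). -/
theorem scht_of_perfect (hP : GaloisHullLift.PerfectHullDescent) : SchurTorsionLayerExtension := scht_of_ext (ext_of_perfect hP)

/-- SCHT is INSTRUMENTABLE by the g26 phantom-twist chain as it stands (tree `ext_of_pieces`; sharper: `scht_of_pieces` below with ELCR♯). -/
theorem scht_of_g26 (hT : TateTwistedExtension) (hW : LayerDeterminantDescent) (hD : AdicRootModTorsion) (hY : FiniteCharacterSplitting)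
    (hR : PerfectLayerRigidity) (hI : ImprimitiveEnlargementDescent) : SchurTorsionLayerExtension :=
  scht_of_ext (ext_of_pieces hT hW hD hY hR hI)

/-! ## §5 Host corollaries BY NAME -/

/-- **Flattened host corollary**: `GaloisHullLift.PerfectHullDescent` (stmt-Langlands-28225) BY NAME from RIGID, FINTYPE, RED°, W1, SCHT —
no print fact (TP), no DIV / LAY. -/
theorem closes_host (hR : PerfectLayerRigidity) (hF : FiniteTypePerfectDescent) (hRed : ReduciblePerfectDescent)
    (hW : LayerDeterminantDescent) (hS : SchurTorsionLayerExtension) : GaloisHullLift.PerfectHullDescent := by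
  have hE : PerfectLayerExtension := ext_of_w1_scht hW hS
  intro K _ _ n hcpt hn π hπ L _ _ _ hGal h1 hnc ℓ _ ι r hr hrel
  by_cases hirr : r.IsIrreducible
  · exact hR K n hcpt hn π hπ L hGal h1 hnc ℓ ι r hr hirr (hE K n hcpt hn π hπ L hGal h1 hnc ℓ ι r hr hirr hrel) hrel
  · by_cases hfin : (∀ᶠ v : IsDedekindDomain.HeightOneSpectrum (NumberField.RingOfIntegers K) in cofinite, ∀ α : Multiset ℂ, π.1.HasSatakeParamAt v α → ∀ a ∈ α, ∀ b ∈ α, ∃ k : ℕ, 0 < k ∧ a ^ k = b ^ k)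
    · exact hF K n hcpt hn π hπ L hGal h1 hnc ℓ ι r hr hirr hfin hrel
    · exact hRed K n hcpt hn π hπ L hGal h1 hnc ℓ ι r hr hirr hfin hrel

/-- Up one level: `CyclicLayerPeeling.AnabelianLayerDescent` (tree `GaloisHullLift.closes`). -/
theorem closes_parent (hR : PerfectLayerRigidity) (hF : FiniteTypePerfectDescent) (hRed : ReduciblePerfectDescent)
    (hW : LayerDeterminantDescent) (hS : SchurTorsionLayerExtension) (hSt : GaloisHullLift.SelfTwistedHullDescent) (hTr : GaloisHullLift.TrivialHullDescent)
    (hC : CyclicLayerPeeling.PrimeCyclicLayerDescent) (hB : CyclicLayerPeeling.CyclicBaseChangeBelow) :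
    CyclicLayerPeeling.AnabelianLayerDescent :=
  GaloisHullLift.closes (closes_host hR hF hRed hW hS) hSt hTr hC hB

/-- Up to the root item: `RootDecomp1.AvatarDescent` (tree `CyclicLayerPeeling.closes`). -/
theorem closes_grandparent (hR : PerfectLayerRigidity) (hF : FiniteTypePerfectDescent) (hRed : ReduciblePerfectDescent)
    (hW : LayerDeterminantDescent) (hS : SchurTorsionLayerExtension) (hSt : GaloisHullLift.SelfTwistedHullDescent) (hTr : GaloisHullLift.TrivialHullDescent)
    (hC : CyclicLayerPeeling.PrimeCyclicLayerDescent) (hB : CyclicLayerPeeling.CyclicBaseChangeBelow)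
    (hS' : CyclicLayerPeeling.SelfTwistedLayerDescent) : RootDecomp1.AvatarDescent :=
  CyclicLayerPeeling.closes hC (closes_parent hR hF hRed hW hS hSt hTr hC hB) hS' hB

/-! ## §6 COMPOSITION WITH THE g26 PHANTOM-TWIST CHAIN: the residual ELCR restricted to Schur-torsion layers (ELCR♯ < ELCR) -/

/-- **ELCR♯ · the g26 residual `ImprimitiveEnlargementDescent` RESTRICTED TO SCHUR-TORSION LAYERS** (the hypothesis
`¬ CentralExtensionsSplitMod n (L ≃ₐ[K] L)` inserted after the no-cyclic-prime-layer hypothesis; otherwise byte-identical to the tree decl,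
sha12 of ELCR unchanged).  ELCR♯ ⟸ ELCR (`elcrSharp_of_elcr`), ELCR♯ ⟸ SCHT (`elcrSharp_of_scht`), hence S-implied; and
SCHT ⟸ TP ∧ W1 ∧ DIV ∧ LAY ∧ RIGID ∧ ELCR♯ (`scht_of_pieces`, the g26 kernel re-run with the layer predicate threaded). -/
def ImprimitiveEnlargementDescentSharp : Prop :=
  ∀ (K : Type) [Field K] [NumberField K] (n : ℕ) (hcpt : Literature.NumberTheory.Automorphic.isCompact_glFiniteIntegralLevel n K), 0 < n → ∀ (π : Literature.NumberTheory.Automorphic.CuspidalAutomorphicRepData n K hcpt), π.1.IsLAlgebraic → ∀ (L : Type) [Field L] [NumberField L] [Algebra K L], IsGalois K L → Module.finrank K L ≠ 1 → (¬ ∃ F : IntermediateField K L, F ≠ ⊥ ∧ IsGalois K ↥F ∧ IsCyclic (↥F ≃ₐ[K] ↥F) ∧ (Module.finrank K ↥F).Prime) → ¬ CentralExtensionsSplitMod n (L ≃ₐ[K] L) → ∀ (ℓ : ℕ) [Fact ℓ.Prime] (ι : PadicAlgCl ℓ ≃+* ℂ) (r : Literature.NumberTheory.GaloisRepresentations.FramedGaloisRep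 L (PadicAlgCl ℓ) n), r.toGaloisRep.IsSemisimple → r.IsIrreducible → (∀ᶠ w : IsDedekindDomain.HeightOneSpectrum (NumberField.RingOfIntegers L) in cofinite, ∀ (v : IsDedekindDomain.HeightOneSpectrum (NumberField.RingOfIntegers K)) (α : Multiset ℂ), w.asIdeal.under (NumberField.RingOfIntegers K) = v.asIdeal → π.1.HasSatakeParamAt v α → r.IsUnramifiedAt w ∧ r.HasFrobCharpolyAt w (Literature.NumberTheory.Automorphic.arithFrobPolyOfSatake ι w.residueCard 1 (α.map (fun a => a ^ w.asIdeal.inertiaDeg (NumberField.RingOfIntegers K))))) → ∀ (L' : Type) [Field L'] [NumberField L'] [Algebra K L'] [Algebra L L'] [IsScalarTower K L L'], IsGalois K L' → (∀ g h : L' ≃ₐ[L] L', g * h = h * g) → ∀ ρ₁ : Literature.NumberTheory.GaloisRepresentations.FramedGaloisRep K (PadicAlgCl ℓ) n, ρ₁.IsIrreducible → (∃ P : GL (Fin n) (PadicAlgCl ℓ), ρ₁.restrictField L' = Literature.NumberTheory.GaloisRepresentations.FramedRep.conj P (r.restrictField L')) → (∀ (χ : Field.absoluteGaloisGroup K →ₜ*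 (PadicAlgCl ℓ)ˣ) (P : GL (Fin n) (PadicAlgCl ℓ)), Literature.NumberTheory.GaloisRepresentations.FramedGaloisRep.restrictField L (Literature.NumberTheory.GaloisRepresentations.FramedRep.twist ρ₁ χ) ≠ Literature.NumberTheory.GaloisRepresentations.FramedRep.conj P r) → ((∃ F : IntermediateField K L', F ≠ ⊥ ∧ IsGalois K ↥F ∧ IsCyclic (↥F ≃ₐ[K] ↥F) ∧ (Module.finrank K ↥F).Prime) ∨ ¬ (r.restrictField L').IsIrreducible) → ∃ ρ₀ : Literature.NumberTheory.GaloisRepresentations.FramedGaloisRep K (PadicAlgCl ℓ) n, ρ₀.toGaloisRep.IsSemisimple ∧ (∀ᶠ w : IsDedekindDomain.HeightOneSpectrum (NumberField.RingOfIntegers L) in cofinite, ∀ (v : IsDedekindDomain.HeightOneSpectrum (NumberField.RingOfIntegers K)) (α : Multiset ℂ), w.asIdeal.under (NumberField.RingOfIntegers K) = v.asIdeal → π.1.HasSatakeParamAt v α → (ρ₀.restrictField L).IsUnramifiedAt w ∧ (ρ₀.restrictField L).HasFrobCharpolyAt w (Literature.NumberTheory.Automorphic.arithFrobPolyOfSatake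 ι w.residueCard 1 (α.map (fun a => a ^ w.asIdeal.inertiaDeg (NumberField.RingOfIntegers K)))))

/-- ELCR♯ ⟸ ELCR (fewer layers). -/
theorem elcrSharp_of_elcr (hI : ImprimitiveEnlargementDescent) : ImprimitiveEnlargementDescentSharp := by
  intro K _ _ n hcpt hn π hπ L _ _ _ hGal h1 hnc hns ℓ _ ι r hr hirr hrel L' _ _ _ _ _ hGal' hab ρ₁ hρ₁ hP hgen hcell
  exact hI K n hcpt hn π hπ L hGal h1 hnc ℓ ι r hr hirr hrel L' hGal' hab ρ₁ hρ₁ hP hgen hcell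

/-- ELCR♯ ⟸ SCHT (drop the enlargement data; same layer predicate). -/
theorem elcrSharp_of_scht (hS : SchurTorsionLayerExtension) : ImprimitiveEnlargementDescentSharp := by
  intro K _ _ n hcpt hn π hπ L _ _ _ hGal h1 hnc hns ℓ _ ι r hr hirr hrel L' _ _ _ _ _ hGal' hab ρ₁ hρ₁ hP hgen hcell
  exact hS K n hcpt hn π hπ L hGal h1 hnc hns ℓ ι r hr hirr hrel

/-- ELCR♯ is S-implied. -/
theorem elcrSharp_of_langlands (hL : _root_.Langlands) : ImprimitiveEnlargementDescentSharp := elcrSharp_of_elcr (elcr_of_langlands hL)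

open scoped Classical in
/-- **SCHT ⟸ TP ∧ W1 ∧ DIV ∧ LAY ∧ RIGID ∧ ELCR♯** — the g26 kernel `TatePhantomLift.ext_of_pieces` VERBATIM with the Schur-torsion predicate of
the layer threaded from SCHT's hypothesis to the residual call (the only two edited lines are the `intro` pattern and the final `exact hI …`). -/
theorem scht_of_pieces (hT : TateTwistedExtension) (hW : LayerDeterminantDescent) (hD : AdicRootModTorsion)
    (hY : FiniteCharacterSplitting) (hR : PerfectLayerRigidity) (hI : ImprimitiveEnlargementDescentSharp) : SchurTorsionLayerExtension := by
  intro K _ _ n hcpt hn π hπ L _ _ _ hGal h1 hnc hns ℓ _ ι r hr hirr hrel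
  haveI := hGal
  -- (1) invariance: `r^τ ≃ r` for all `τ ∈ Γ_K` (Chebotarev–Brauer–Nesbitt over `L`)
  have hinv : ∀ τ : Field.absoluteGaloisGroup K, ∃ P : GL (Fin n) (PadicAlgCl ℓ),
      FramedRep.conj P (FramedGaloisRep.outerConj τ r) = r := relAvatar_invariant π.1 ι r hr hrel
  -- (2) Tate–Clifford: `ρ₁|Γ_L = r ⊗ c`
  obtain ⟨ρ₁, c, hρ₁⟩ := hT K L ℓ n r hirr hinv
  -- (3) the determinant of `r` descends
  obtain ⟨Ψ₀, hΨ₀⟩ := hW K n hcpt hn π hπ L hGal h1 hnc ℓ ι r hr hirr hrel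
  -- `cⁿ = Φ|Γ_L` with `Φ := det ρ₁ · Ψ₀⁻¹`
  set Φ : Field.absoluteGaloisGroup K →ₜ* (PadicAlgCl ℓ)ˣ := FramedRep.det ρ₁ * Ψ₀⁻¹ with hΦ
  have hcn : ∀ σ : Field.absoluteGaloisGroup L, c σ ^ n = Φ (absGaloisRestrict K L σ) := by
    intro σ
    have hdet : Matrix.GeneralLinearGroup.det (ρ₁ (absGaloisRestrict K L σ)) = c σ ^ n * Matrix.GeneralLinearGroup.det (r σ) := by
      change Matrix.GeneralLinearGroup.det ((ρ₁.restrictField L) σ) = _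
      rw [hρ₁, FramedRep.det_twist_apply]
    rw [hΦ, ContinuousMonoidHom.mul_apply, padicChar_inv_apply, FramedRep.det_apply, hdet, hΨ₀ σ, mul_inv_cancel_right]
  -- (4) divide: `ψⁿ ≡ Φ` modulo torsion; `c' := c · (ψ|Γ_L)⁻¹` has finite order `n·m`
  obtain ⟨ψ, m, hm, hψ⟩ := hD K ℓ Φ n hn
  set c' : Field.absoluteGaloisGroup L →ₜ* (PadicAlgCl ℓ)ˣ := c * (ψ.comp (absGaloisRestrict K L))⁻¹ with hc'
  have hfin : ∀ σ : Field.absoluteGaloisGroup L, c' σ ^ (n * m) = 1 := by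
    intro σ
    have h := hψ (absGaloisRestrict K L σ)
    rw [← hcn σ] at h
    -- invert: `(c σ ^ n * (ψ (res σ) ^ n)⁻¹) ^ m = 1`
    have h' := congrArg Inv.inv h
    rw [inv_one, ← inv_pow, mul_inv_rev, inv_inv] at h'
    have e1 : c' σ ^ (n * m) = (c σ ^ n * (ψ (absGaloisRestrict K L σ) ^ n)⁻¹) ^ m := by
      rw [pow_mul, ← inv_pow, ← mul_pow, hc']
      rfl
    rw [e1]
    exact h'
  -- (5) kill `c'` on a finite Galois `L'/K ⊇ L` with `Gal(L'/L)` abelian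
  obtain ⟨L', iF, iN, iA, iA', iT, hGal', hab, hc'1⟩ := hY K L hGal ℓ c' ⟨n * m, Nat.mul_pos hn hm, hfin⟩
  -- the re-twisted extension `ρ₁' := ρ₁ ⊗ ψ⁻¹` restricts to `r ⊗ c'` on `Γ_L` …
  set ρ₁' : FramedGaloisRep K (PadicAlgCl ℓ) n := FramedRep.twist ρ₁ ψ⁻¹ with hρ₁'
  have h8 : ρ₁'.restrictField L = FramedRep.twist r c' := by
    rw [hρ₁', restrictField_twist, hρ₁, FramedRep.twist_twist, hc']
    congr 1
    exact ContinuousMonoidHom.ext fun σ => by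
      rw [ContinuousMonoidHom.mul_apply, ContinuousMonoidHom.mul_apply, cmh_comp_apply, padicChar_inv_apply, padicChar_inv_apply, cmh_comp_apply]
      exact mul_comm _ _
  -- … hence is irreducible (and semisimple) …
  have hirr₁ : ρ₁'.IsIrreducible := isIrreducible_of_restrictField ρ₁' (h8 ▸ isIrreducible_twist r c' hirr)
  have hss₁ : ρ₁'.toGaloisRep.IsSemisimple := by
    haveI : ρ₁'.toGaloisRep.toRepresentation.IsIrreducible := hirr₁
    change ComplementedLattice _
    infer_instance
  -- … and to a CONJUGATE of `r|Γ_{L'}` on `Γ_{L'}` (`c'` dies there; the tower costs an inner automorphism)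
  obtain ⟨τ, hτ⟩ := exists_restrictField_restrictField_eq_conj (K := K) (L := L) (ℓ := ℓ) (n := n) L'
  have hcomp1 : c'.comp (absGaloisRestrict L L') = 1 := ContinuousMonoidHom.ext fun σ => hc'1 σ
  have key : ρ₁'.restrictField L' = FramedRep.conj (ρ₁' τ) (r.restrictField L') := by
    have h := hτ ρ₁'
    rw [h8, restrictField_twist, hcomp1, FramedRep.twist_one] at h
    -- h : r.restrictField L' = conj (ρ₁' τ)⁻¹ (ρ₁'.restrictField L')
    rw [h, conj_conj, mul_inv_cancel, conj_one]
  -- (5½) is the phantom GENUINE?  If some `Γ_K`-twist of `ρ₁'` restricts to a conjugate of `r` on `Γ_L`, that twist (re-framed) extends `r`: done.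
  by_cases hgen : ∃ (χ : Field.absoluteGaloisGroup K →ₜ* (PadicAlgCl ℓ)ˣ) (P : GL (Fin n) (PadicAlgCl ℓ)),
      FramedGaloisRep.restrictField L (FramedRep.twist ρ₁' χ) = FramedRep.conj P r
  · obtain ⟨χ, P, hχ⟩ := hgen
    set ρ₀ : FramedGaloisRep K (PadicAlgCl ℓ) n := FramedRep.conj P⁻¹ (FramedRep.twist ρ₁' χ) with hρ₀
    have h0 : ρ₀.restrictField L = r := by
      rw [hρ₀, restrictField_conj, hχ, conj_conj, inv_mul_cancel, conj_one]
    have hirr₀ : ρ₀.IsIrreducible := isIrreducible_of_restrictField ρ₀ (h0 ▸ hirr : (ρ₀.restrictField L).IsIrreducible)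
    have hss₀ : ρ₀.toGaloisRep.IsSemisimple := by
      haveI : ρ₀.toGaloisRep.toRepresentation.IsIrreducible := hirr₀
      change ComplementedLattice _
      infer_instance
    refine ⟨ρ₀, hss₀, ?_⟩
    rw [h0]
    exact hrel
  have hgen' : ∀ (χ : Field.absoluteGaloisGroup K →ₜ* (PadicAlgCl ℓ)ˣ) (P : GL (Fin n) (PadicAlgCl ℓ)),
      FramedGaloisRep.restrictField L (FramedRep.twist ρ₁' χ) ≠ FramedRep.conj P r := fun χ P h => hgen ⟨χ, P, h⟩
  -- (6)/(7) case split on the enlarged layer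
  by_cases hstem : (¬ ∃ F : IntermediateField K L', F ≠ ⊥ ∧ IsGalois K ↥F ∧ IsCyclic (↥F ≃ₐ[K] ↥F) ∧ (Module.finrank K ↥F).Prime) ∧
      (r.restrictField L').IsIrreducible
  · -- STEM: RIGID one floor up, with candidate `ρ₁'`
    haveI := hGal'
    haveI : IsGalois L L' := IsGalois.tower_top_of_isGalois K L L'
    have h1' : Module.finrank K L' ≠ 1 := by
      intro h
      haveI : FiniteDimensional K L := Module.Finite.of_restrictScalars_finite ℚ K L
      haveI : FiniteDimensional L L' := Module.Finite.of_restrictScalars_finite ℚ L L'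
      have hmul := Module.finrank_mul_finrank K L L'
      rw [h] at hmul
      exact h1 (Nat.eq_one_of_mul_eq_one_right hmul)
    have hr' : (r.restrictField L').toGaloisRep.IsSemisimple := r.isSemisimple_restrictField hr
    have hrel' := relAvatar_tower π.1 ι r hrel L'
    have hcand := relAvatar_conj π.1 ι (r.restrictField L') (ρ₁' τ) hrel'
    rw [← key] at hcand
    obtain ⟨ρ, hρ, hc⟩ := hR K n hcpt hn π hπ L' hGal' h1' hstem.1 ℓ ι (r.restrictField L') hr' hstem.2 ⟨ρ₁', hss₁, hcand⟩ hrel'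
    exact ⟨ρ, hρ, relAvatar_restrictField_of_compatible π.1 ι ρ hc⟩
  · -- IMPRIMITIVE CELL: the declared residual
    have hcase : (∃ F : IntermediateField K L', F ≠ ⊥ ∧ IsGalois K ↥F ∧ IsCyclic (↥F ≃ₐ[K] ↥F) ∧ (Module.finrank K ↥F).Prime) ∨
        ¬ (r.restrictField L').IsIrreducible := by
      rcases not_and_or.mp hstem with h | h
      · exact Or.inl (not_not.mp h)
      · exact Or.inr h
    exact hI K n hcpt hn π hπ L hGal h1 hnc hns ℓ ι r hr hirr hrel L' hGal' hab ρ₁' hirr₁ ⟨ρ₁' τ, key⟩ hgen' hcase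

/-- **EXT ⟸ TP ∧ W1 ∧ DIV ∧ LAY ∧ RIGID ∧ ELCR♯** (g26's kernel with its residual sharpened: Schur-split layers need only W1). -/
theorem ext_of_pieces_sharp (hT : TateTwistedExtension) (hW : LayerDeterminantDescent) (hD : AdicRootModTorsion)
    (hY : FiniteCharacterSplitting) (hR : PerfectLayerRigidity) (hI : ImprimitiveEnlargementDescentSharp) : PerfectLayerExtension :=
  ext_of_w1_scht hW (scht_of_pieces hT hW hD hY hR hI)

/-- Exactness of the sharp chain modulo the excess facts: given TP, DIV, LAY, RIGID, EXT ↔ W1 ∧ ELCR♯. -/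
theorem ext_iff_pieces_sharp (hT : TateTwistedExtension) (hD : AdicRootModTorsion) (hY : FiniteCharacterSplitting) (hR : PerfectLayerRigidity) :
    PerfectLayerExtension ↔ (LayerDeterminantDescent ∧ ImprimitiveEnlargementDescentSharp) :=
  ⟨fun h => ⟨w1_of_ext h, elcrSharp_of_elcr (elcr_of_ext h)⟩, fun h => ext_of_pieces_sharp hT h.1 hD hY hR h.2⟩

/-- **Flattened host corollary, sharp form** = the `Assembly` of the kit variant `PerfectLayerClifford` v2e:
RIGID → FINTYPE → RED° → TP → W1 → DIV → LAY → ELCR♯ → `GaloisHullLift.PerfectHullDescent` (stmt-Langlands-28225) BY NAME. -/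
theorem closes_host_sharp (hR : PerfectLayerRigidity) (hF : FiniteTypePerfectDescent) (hRed : ReduciblePerfectDescent)
    (hT : TateTwistedExtension) (hW : LayerDeterminantDescent) (hDv : AdicRootModTorsion) (hY : FiniteCharacterSplitting)
    (hI : ImprimitiveEnlargementDescentSharp) : GaloisHullLift.PerfectHullDescent :=
  closes_host hR hF hRed hW (scht_of_pieces hT hW hDv hY hR hI)

/-- Up the chain from the sharp pieces: ANAB (stmt 27861) and AvDesc (stmt 29149). -/
theorem closes_grandparent_sharp (hR : PerfectLayerRigidity) (hF : FiniteTypePerfectDescent) (hRed : ReduciblePerfectDescent)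
    (hT : TateTwistedExtension) (hW : LayerDeterminantDescent) (hDv : AdicRootModTorsion) (hY : FiniteCharacterSplitting)
    (hI : ImprimitiveEnlargementDescentSharp) (hSt : GaloisHullLift.SelfTwistedHullDescent) (hTr : GaloisHullLift.TrivialHullDescent)
    (hC : CyclicLayerPeeling.PrimeCyclicLayerDescent) (hB : CyclicLayerPeeling.CyclicBaseChangeBelow)
    (hS' : CyclicLayerPeeling.SelfTwistedLayerDescent) : RootDecomp1.AvatarDescent :=
  closes_grandparent hR hF hRed hW (scht_of_pieces hT hW hDv hY hR hI) hSt hTr hC hB hS'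

end Summit.Langlands.Langlands.Theorems.SchurObstructionExit
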